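import Mathlib.GroupTheory.FreeGroup.NielsenSchreier
import Mathlib.GroupTheory.Index
import Mathlib.GroupTheory.QuotientGroup.Basic
import Mathlib.Algebra.Group.Subgroup.Pointwise
import Mathlib.GroupTheory.GroupAction.ConjAct
import Mathlib.Data.ZMod.Basic
import Mathlib.GroupTheory.SpecificGroups.Cyclic
import Mathlib.Tactic.Group
import HarnessLib

/-!
# Characters of a free factor extend from a level to the whole level: the fibred twist

Topic `Literature/GroupTheory/CombinatorialGroupTheory`; theorems only, Mathlib-only.  Serre, *Trees*
(Springer 1980), I §5.5, Thm. 14 (subgroups of a free product act on the tree; here only its elementary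
`H¹` shadow for a FREE factor is needed) [cite: SerreTrees1980, I §5.5 Thm. 14]; Lyndon–Schupp,
*Combinatorial Group Theory*, Prop. I.3.8 (Schreier transversals / coset graphs of a free group).

**Setting.**  `Γ` a free group with basis `b : β → Γ`, `S ⊆ β`, `Γ_S := ⟨b(S)⟩` the free factor it spans,
`N ⊴ Γ` ANY normal subgroup (a "level"), `B := Γ_S ∩ N` (the level seen from the factor), `f ∈ Γ`.

**Theorem `exists_character_extension_of_freeFactor`.**  Every character `φ : B → M` (`M` abelian)
is the restriction of a character `χ : N → M` of the whole level along `x ↦ f x f⁻¹`, namely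
`χ(f x f⁻¹) = φ(x)` for `x ∈ B`, which moreover KILLS every conjugate `g B g⁻¹` with `g ∉ f·Γ_S·N`.
(Coset-graph reading: `N = π₁` of the Schreier graph of `Γ/N`; the `Γ_S`-orbits of `Γ/N` are the
`S`-coloured components; `χ` is "`φ` on the component of `f⁻¹N`, extended by zero".)

Construction (the FIBRED TWIST; no Reidemeister–Schreier, no Kurosh / Bass–Serre).  Let `Q = Γ/N`,
`Ā` the image of `Γ_S`, and `O = {q : q·π(f) ∈ Ā}` the `Γ_S`-orbit of `π(f⁻¹)`.  On `X = Q × M` let a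
basis letter `b_j`, `j ∉ S`, act by `(q, m) ↦ (b_j q, m)`, and `a ∈ Γ_S` by
`(q, m) ↦ (a q, m · c(a, q))` with `c(a, q) = φ(s(aq)⁻¹ a s(q))` for `q ∈ O` (`s` a section of `O`
with values in `Γ_S`, `π(s(q)) = q·π(f)`) and `c(a, q) = 1` off `O` — a cocycle, so this is a
`Γ_S`-action, and the basis being FREE the two prescriptions define a `Γ`-action `ρ` (no relation to
check).  It covers the left translation action on `Q` and commutes with right translation by `M`; hence
`N` acts on each fibre by translations and `χ(n) := pr₂(ρ(n)(1, 1))` is a homomorphism with the two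
displayed properties.

**Corollary `exists_normal_index_eq_separating_of_freeFactor`** (the form consumed by [CombGC] Prop. 1.2,
proof p. 9, "separating coverings", verticial case at ONE vertex —
`Literature/AnabelianGeometry/SemiGraphs/PSCSeparatingCoveringsSameVertex.lean`): if `B ≠ 1` and `ℓ` is
prime there is `U ⊴ N` of index `ℓ` with `f B f⁻¹ ⊄ U` but `g B g⁻¹ ⊆ U` for all `g` with
`f⁻¹ g ∉ Γ_S N` — a cyclic degree-`ℓ` covering of the level, nontrivial over ONE vertex above the factor
and trivial over all the others.  No finiteness of `Γ/N` is needed for the theorem; the corollary's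
non-vacuity lemma `freeFactor_inf_ne_bot` uses `[Γ : N] < ∞`.  Elementary; nothing here concerns
[IUTchIII].
-/

namespace Literature.GroupTheory.CombinatorialGroupTheory

namespace FreeFactorFibredTwist

open scoped Pointwise

variable {Γ : Type*} [Group Γ] {β : Type*}

/-- `b.lift f (b i) = f i` for a free basis `b`. [cite: SerreTrees1980, I §5.5 Thm. 14] -/
theorem lift_apply_basis {H : Type*} [Group H] (b : FreeGroupBasis β Γ) (f : β → H) (i : β) :
    b.lift f (b i) = f i := by
  change FreeGroup.lift f (b.repr (b i)) = f i
  rw [FreeGroupBasis.repr_apply_coe, FreeGroup.lift_apply_of]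

/-- A free basis generates. [cite: SerreTrees1980, I §5.5 Thm. 14] -/
theorem mem_closure_range_basis (b : FreeGroupBasis β Γ) (g : Γ) :
    g ∈ Subgroup.closure (Set.range (b : β → Γ)) := by
  obtain ⟨w, rfl⟩ := b.repr.symm.surjective g
  refine FreeGroup.induction_on w ?_ ?_ ?_ ?_
  · rw [map_one]; exact one_mem _
  · exact fun x => Subgroup.subset_closure ⟨x, rfl⟩
  · intro x hx
    rw [map_inv]
    exact inv_mem hx
  · intro x y hx hy
    rw [map_mul]
    exact mul_mem hx hy

/-- An abelian-valued character of a subgroup is invariant under conjugation inside the subgroup.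
[cite: SerreTrees1980, I §5.5 Thm. 14] -/
theorem apply_conj_eq {M : Type*} [CommGroup M] {B : Subgroup Γ} (φ : B →* M) {x u : Γ}
    (hx : x ∈ B) (hu : u ∈ B) (h : u⁻¹ * x * u ∈ B) : φ ⟨u⁻¹ * x * u, h⟩ = φ ⟨x, hx⟩ := by
  have hprod : (⟨u⁻¹ * x * u, h⟩ : B) = ⟨u, hu⟩⁻¹ * ⟨x, hx⟩ * ⟨u, hu⟩ := Subtype.ext rfl
  rw [hprod, map_mul, map_mul, map_inv, mul_comm (φ ⟨u, hu⟩)⁻¹, mul_assoc, inv_mul_cancel, mul_one]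

/-- `N·Γ_S = Γ_S·N` for `N` normal. [cite: SerreTrees1980, I §5.5 Thm. 14] -/
theorem normal_coe_mul_comm (A N : Subgroup Γ) [N.Normal] :
    (N : Set Γ) * (A : Set Γ) = (A : Set Γ) * (N : Set Γ) := by
  rw [← Subgroup.normal_mul, sup_comm, Subgroup.mul_normal]

/-- **Characters of a free factor extend from a level to the whole level (fibred twist).**  For a free
group `Γ` with basis `b`, `S ⊆ β`, `Γ_S = ⟨b(S)⟩`, a normal subgroup `N ⊴ Γ`, an abelian group `M`, a
character `φ` of `Γ_S ∩ N` and `f ∈ Γ`: there is a character `χ : N → M` with `χ(f x f⁻¹) = φ(x)` on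
`Γ_S ∩ N` and `χ(g x g⁻¹) = 1` for `x ∈ Γ_S ∩ N` whenever `f⁻¹ g ∉ Γ_S · N`.
[cite: SerreTrees1980, I §5.5 Thm. 14] -/
theorem exists_character_extension_of_freeFactor (b : FreeGroupBasis β Γ) (S : Set β)
    (A : Subgroup Γ) (hA : A = Subgroup.closure (b '' S))
    (N : Subgroup Γ) [hN : N.Normal] {M : Type*} [CommGroup M] (φ : ↥(A ⊓ N) →* M) (f : Γ) :
    ∃ χ : N →* M,
      (∀ (x : Γ) (hx : x ∈ A ⊓ N), χ ⟨f * x * f⁻¹, hN.conj_mem x hx.2 f⟩ = φ ⟨x, hx⟩) ∧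
      ∀ g : Γ, f⁻¹ * g ∉ (A : Set Γ) * (N : Set Γ) →
        ∀ (x : Γ) (hx : x ∈ A ⊓ N), χ ⟨g * x * g⁻¹, hN.conj_mem x hx.2 g⟩ = 1 := by
  classical
  -- the quotient `Q = Γ/N`, the image `Ā` of the factor, the orbit `O` of `π(f⁻¹)`
  set π : Γ →* Γ ⧸ N := QuotientGroup.mk' N with hπ
  have hπN : ∀ {x : Γ}, π x = 1 ↔ x ∈ N := fun {x} => by
    rw [hπ, QuotientGroup.mk'_apply, QuotientGroup.eq_one_iff]
  set Abar : Subgroup (Γ ⧸ N) := A.map π with hAbar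
  have hAN : ∀ {x : Γ}, π x ∈ Abar ↔ x ∈ (A : Set Γ) * (N : Set Γ) := fun {x} => by
    have hk : A ⊔ N = Abar.comap π := by
      rw [hAbar, Subgroup.comap_map_eq, hπ, QuotientGroup.ker_mk']
    rw [← Subgroup.mul_normal A N, SetLike.mem_coe, hk, Subgroup.mem_comap]
  let O : Set (Γ ⧸ N) := {q | q * π f ∈ Abar}
  have hO_iff : ∀ q, q ∈ O ↔ q * π f ∈ Abar := fun q => Iff.rfl
  have hO_mul : ∀ {a : Γ}, a ∈ A → ∀ q, π a * q ∈ O ↔ q ∈ O := by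
    intro a ha q
    rw [hO_iff, hO_iff, mul_assoc]
    exact Subgroup.mul_mem_cancel_left _ (Subgroup.mem_map_of_mem π ha)
  -- a section of the orbit with values in `Γ_S`: `π (s q) = q * π f` for `q ∈ O`
  have hsec : ∀ q ∈ O, ∃ a ∈ A, π a = q * π f := fun q hq => Subgroup.mem_map.mp hq
  let s : Γ ⧸ N → Γ := fun q => if hq : q ∈ O then (hsec q hq).choose else 1
  have hsA : ∀ {q}, q ∈ O → s q ∈ A := fun {q} hq => by
    simp only [s, dif_pos hq]; exact (hsec q hq).choose_spec.1
  have hsπ : ∀ {q}, q ∈ O → π (s q) = q * π f := fun {q} hq => by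
    simp only [s, dif_pos hq]; exact (hsec q hq).choose_spec.2
  -- transition elements and the cocycle `c`
  have ht : ∀ {a : Γ} {q : Γ ⧸ N}, a ∈ A → q ∈ O → (s (π a * q))⁻¹ * a * s q ∈ A ⊓ N := by
    intro a q ha hq
    refine Subgroup.mem_inf.mpr
      ⟨A.mul_mem (A.mul_mem (A.inv_mem (hsA ((hO_mul ha q).mpr hq))) ha) (hsA hq), ?_⟩
    rw [← hπN, map_mul, map_mul, map_inv, hsπ ((hO_mul ha q).mpr hq), hsπ hq]
    group
  let c : Γ → Γ ⧸ N → M := fun a q =>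
    if h : a ∈ A ∧ q ∈ O then φ ⟨(s (π a * q))⁻¹ * a * s q, ht h.1 h.2⟩ else 1
  have hc_of_pos : ∀ {a q} (ha : a ∈ A) (hq : q ∈ O),
      c a q = φ ⟨(s (π a * q))⁻¹ * a * s q, ht ha hq⟩ := fun {a q} ha hq => by
    simp only [c, dif_pos (And.intro ha hq)]
  have hc_of_not : ∀ {a q}, q ∉ O → c a q = 1 := fun {a q} hq =>
    dif_neg (show ¬ (a ∈ A ∧ q ∈ O) from fun h => hq h.2)
  have hc_cocycle : ∀ {a a' : Γ}, a ∈ A → a' ∈ A → ∀ q,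
      c (a * a') q = c a (π a' * q) * c a' q := by
    intro a a' ha ha' q
    by_cases hq : q ∈ O
    · have hq' : π a' * q ∈ O := (hO_mul ha' q).mpr hq
      rw [hc_of_pos (A.mul_mem ha ha') hq, hc_of_pos ha hq', hc_of_pos ha' hq, ← map_mul]
      congr 1
      apply Subtype.ext
      change (s (π (a * a') * q))⁻¹ * (a * a') * s q =
        (s (π a * (π a' * q)))⁻¹ * a * s (π a' * q) * ((s (π a' * q))⁻¹ * a' * s q)
      rw [map_mul, mul_assoc (π a)]
      group
    · have hq' : π a' * q ∉ O := fun h => hq ((hO_mul ha' q).mp h)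
      rw [hc_of_not hq, hc_of_not hq', hc_of_not hq, mul_one]
  have hc_one : ∀ q, c 1 q = 1 := fun q => by
    have h := hc_cocycle A.one_mem A.one_mem q
    rw [mul_one, map_one, one_mul] at h
    exact mul_eq_left.mp h.symm
  -- the twisted action of `Γ_S` on `X = Q × M`
  let T : Γ → (Γ ⧸ N) × M → (Γ ⧸ N) × M := fun a x => (π a * x.1, x.2 * c a x.1)
  have hT : ∀ a q m₀, T a (q, m₀) = (π a * q, m₀ * c a q) := fun _ _ _ => rfl
  have hT_mul : ∀ {a a' : Γ}, a ∈ A → a' ∈ A → ∀ x, T (a * a') x = T a (T a' x) := by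
    rintro a a' ha ha' ⟨q, m₀⟩
    change (π (a * a') * q, m₀ * c (a * a') q) = (π a * (π a' * q), m₀ * c a' q * c a (π a' * q))
    rw [map_mul, mul_assoc (π a) (π a') q, hc_cocycle ha ha', mul_assoc m₀,
      mul_comm (c a (π a' * q)) (c a' q)]
  have hT_one : ∀ x, T 1 x = x := by
    rintro ⟨q, m₀⟩
    rw [hT, map_one, one_mul, hc_one, mul_one]
  let perm : ∀ a : Γ, a ∈ A → Equiv.Perm ((Γ ⧸ N) × M) := fun a ha =>
    { toFun := T a
      invFun := T a⁻¹
      left_inv := fun x => by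
        rw [← hT_mul (A.inv_mem ha) ha, inv_mul_cancel, hT_one]
      right_inv := fun x => by
        rw [← hT_mul ha (A.inv_mem ha), mul_inv_cancel, hT_one] }
  have hperm : ∀ {a} (ha : a ∈ A) x, perm a ha x = T a x := fun _ _ => rfl
  -- the untwisted action of the remaining basis letters
  let plain : Γ → Equiv.Perm ((Γ ⧸ N) × M) := fun g =>
    (Equiv.mulLeft (π g)).prodCongr (Equiv.refl M)
  have hplain : ∀ g q m₀, plain g (q, m₀) = (π g * q, m₀) := fun _ _ _ => rfl
  -- the `Γ`-action, basis letter by basis letter (free: no relation to check)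
  have hbS : ∀ {i}, i ∈ S → b i ∈ A := fun {i} hi => by
    rw [hA]; exact Subgroup.subset_closure (Set.mem_image_of_mem b hi)
  let ρ : Γ →* Equiv.Perm ((Γ ⧸ N) × M) :=
    b.lift fun i => if hi : i ∈ S then perm (b i) (hbS hi) else plain (b i)
  have hρ_basis : ∀ i, ρ (b i) = if hi : i ∈ S then perm (b i) (hbS hi) else plain (b i) :=
    fun i => lift_apply_basis b _ i
  -- (1) on the factor, `ρ` is the twisted action
  have hρA : ∀ (a : Γ) (ha : a ∈ A) (x : (Γ ⧸ N) × M), ρ a x = T a x := by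
    have hmemA : ∀ {a}, a ∈ Subgroup.closure (b '' S) → a ∈ A := fun h => by rw [hA]; exact h
    intro a ha
    have ha' : a ∈ Subgroup.closure (b '' S) := by rw [← hA]; exact ha
    refine Subgroup.closure_induction (p := fun a _ => ∀ x, ρ a x = T a x) ?_ ?_ ?_ ?_ ha'
    · rintro _ ⟨i, hi, rfl⟩ x
      rw [hρ_basis i, dif_pos hi, hperm (hbS hi)]
    · intro x
      rw [map_one, hT_one, Equiv.Perm.one_apply]
    · intro a a' ha ha' iha iha' x
      rw [map_mul, Equiv.Perm.mul_apply, iha', iha, hT_mul (hmemA ha) (hmemA ha')]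
    · intro a ha iha x
      have h := iha (ρ a⁻¹ x)
      rw [← Equiv.Perm.mul_apply, ← map_mul, mul_inv_cancel, map_one, Equiv.Perm.one_apply] at h
      calc ρ a⁻¹ x = T a⁻¹ (T a (ρ a⁻¹ x)) := by
              rw [← hT_mul (A.inv_mem (hmemA ha)) (hmemA ha), inv_mul_cancel, hT_one]
        _ = T a⁻¹ x := by rw [← h]
  -- (2) `ρ` covers left translation on `Q`; (3) `ρ` commutes with right translation by `M`
  have hρ_fst_snd : ∀ g : Γ, (∀ (q : Γ ⧸ N) (m₀ : M), (ρ g (q, m₀)).1 = π g * q) ∧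
      ∀ (q : Γ ⧸ N) (m₀ m : M), ρ g (q, m₀ * m) = ((ρ g (q, m₀)).1, (ρ g (q, m₀)).2 * m) := by
    intro g
    refine Subgroup.closure_induction (p := fun g _ => (∀ (q : Γ ⧸ N) (m₀ : M),
        (ρ g (q, m₀)).1 = π g * q) ∧
      ∀ (q : Γ ⧸ N) (m₀ m : M), ρ g (q, m₀ * m) = ((ρ g (q, m₀)).1, (ρ g (q, m₀)).2 * m))
      ?_ ?_ ?_ ?_ (mem_closure_range_basis b g)
    · rintro _ ⟨i, rfl⟩
      by_cases hi : i ∈ S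
      · refine ⟨fun q m₀ => ?_, fun q m₀ m => ?_⟩
        · rw [hρ_basis i, dif_pos hi, hperm (hbS hi), hT]
        · rw [hρ_basis i, dif_pos hi, hperm (hbS hi), hperm (hbS hi), hT, hT, mul_right_comm]
      · refine ⟨fun q m₀ => ?_, fun q m₀ m => ?_⟩
        · rw [hρ_basis i, dif_neg hi, hplain]
        · rw [hρ_basis i, dif_neg hi, hplain, hplain]
    · refine ⟨fun q m₀ => ?_, fun q m₀ m => ?_⟩
      · rw [map_one, Equiv.Perm.one_apply, map_one, one_mul]
      · rw [map_one, Equiv.Perm.one_apply, Equiv.Perm.one_apply]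
    · rintro g g' - - ⟨ih₁, ih₂⟩ ⟨ih₁', ih₂'⟩
      refine ⟨fun q m₀ => ?_, fun q m₀ m => ?_⟩
      · rw [map_mul, Equiv.Perm.mul_apply, map_mul, mul_assoc, ← ih₁' q m₀]
        obtain ⟨q', m'⟩ := ρ g' (q, m₀)
        exact ih₁ q' m'
      · rw [map_mul, Equiv.Perm.mul_apply, Equiv.Perm.mul_apply, ih₂']
        obtain ⟨q', m'⟩ := ρ g' (q, m₀)
        exact ih₂ q' m' m
    · rintro g - ⟨ih₁, ih₂⟩
      have hinv : ∀ (q : Γ ⧸ N) (m₀ : M), ρ g (ρ g⁻¹ (q, m₀)) = (q, m₀) := fun q m₀ => by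
        rw [← Equiv.Perm.mul_apply, ← map_mul, mul_inv_cancel, map_one, Equiv.Perm.one_apply]
      refine ⟨fun q m₀ => ?_, fun q m₀ m => ?_⟩
      · have h1 := ih₁ (ρ g⁻¹ (q, m₀)).1 (ρ g⁻¹ (q, m₀)).2
        rw [Prod.mk.eta, hinv] at h1
        rw [show π g⁻¹ = (π g)⁻¹ from map_inv π g, eq_inv_mul_iff_mul_eq]
        exact h1.symm
      · have h2 := ih₂ (ρ g⁻¹ (q, m₀)).1 (ρ g⁻¹ (q, m₀)).2 m
        rw [Prod.mk.eta, hinv] at h2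
        have h3 := congrArg (ρ g⁻¹) h2
        rw [← Equiv.Perm.mul_apply, ← map_mul, inv_mul_cancel, map_one, Equiv.Perm.one_apply] at h3
        exact h3.symm
  have hρ_fst : ∀ (g : Γ) (q : Γ ⧸ N) (m₀ : M), (ρ g (q, m₀)).1 = π g * q :=
    fun g => (hρ_fst_snd g).1
  have hρ_snd : ∀ (g : Γ) (q : Γ ⧸ N) (m₀ m : M),
      ρ g (q, m₀ * m) = ((ρ g (q, m₀)).1, (ρ g (q, m₀)).2 * m) := fun g => (hρ_fst_snd g).2
  -- elements of `N` fix the first coordinate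
  have hρN : ∀ {n : Γ}, n ∈ N → ∀ (q : Γ ⧸ N) (m₀ : M), ρ n (q, m₀) = (q, (ρ n (q, m₀)).2) := by
    intro n hn q m₀
    exact Prod.ext (by rw [hρ_fst, hπN.mpr hn, one_mul]) rfl
  -- the character `χ(n) = pr₂ (ρ n (1, 1))`
  let χ : N →* M :=
    { toFun := fun n => (ρ (n : Γ) ((1 : Γ ⧸ N), (1 : M))).2
      map_one' := by
        change (ρ ((1 : N) : Γ) ((1 : Γ ⧸ N), (1 : M))).2 = 1
        rw [OneMemClass.coe_one, map_one, Equiv.Perm.one_apply]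
      map_mul' := fun n n' => by
        change (ρ ((n : Γ) * n') ((1 : Γ ⧸ N), (1 : M))).2 =
          (ρ (n : Γ) ((1 : Γ ⧸ N), (1 : M))).2 * (ρ (n' : Γ) ((1 : Γ ⧸ N), (1 : M))).2
        have e' : ρ (n' : Γ) ((1 : Γ ⧸ N), (1 : M)) = (1, (ρ (n' : Γ) ((1 : Γ ⧸ N), (1 : M))).2) :=
          hρN n'.2 1 1
        have h := hρ_snd (n : Γ) 1 1 (ρ (n' : Γ) ((1 : Γ ⧸ N), (1 : M))).2
        rw [one_mul] at h
        rw [map_mul ρ, Equiv.Perm.mul_apply, e', h] }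
  have hχ : ∀ (n : Γ) (hn : n ∈ N), χ ⟨n, hn⟩ = (ρ n ((1 : Γ ⧸ N), (1 : M))).2 := fun _ _ => rfl
  -- `χ (g x g⁻¹) = c x (π g⁻¹)` for `x ∈ Γ_S ∩ N`
  have hχ_conj : ∀ (g x : Γ) (hx : x ∈ A ⊓ N),
      χ ⟨g * x * g⁻¹, hN.conj_mem x hx.2 g⟩ = c x (π g⁻¹) := by
    intro g x hx
    rw [hχ, map_mul ρ, map_mul ρ, Equiv.Perm.mul_apply, Equiv.Perm.mul_apply]
    set y := ρ g⁻¹ ((1 : Γ ⧸ N), (1 : M)) with hy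
    have hy1 : y.1 = π g⁻¹ := by
      have h := hρ_fst g⁻¹ 1 1
      rw [← hy, mul_one] at h
      exact h
    have hxy : ρ x y = (y.1, y.2 * c x (π g⁻¹)) := by
      rw [hρA x hx.1]
      change (π x * y.1, y.2 * c x y.1) = (y.1, y.2 * c x (π g⁻¹))
      rw [hπN.mpr hx.2, one_mul, hy1]
    rw [hxy, hρ_snd g y.1 y.2, Prod.mk.eta, hy, ← Equiv.Perm.mul_apply, ← map_mul, mul_inv_cancel,
      map_one, Equiv.Perm.one_apply]
    exact one_mul _
  refine ⟨χ, fun x hx => ?_, fun g hg x hx => ?_⟩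
  · -- `χ (f x f⁻¹) = φ x`
    rw [hχ_conj f x hx]
    have hfO : π f⁻¹ ∈ O := by
      rw [hO_iff, ← map_mul, inv_mul_cancel, map_one]
      exact one_mem _
    have hsf : s (π f⁻¹) ∈ A ⊓ N := by
      refine Subgroup.mem_inf.mpr ⟨hsA hfO, ?_⟩
      rw [← hπN, hsπ hfO, ← map_mul, inv_mul_cancel, map_one]
    rw [hc_of_pos hx.1 hfO]
    have hmem : (s (π f⁻¹))⁻¹ * x * s (π f⁻¹) ∈ A ⊓ N :=
      (A ⊓ N).mul_mem ((A ⊓ N).mul_mem ((A ⊓ N).inv_mem hsf) hx) hsf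
    have heq : (⟨(s (π x * π f⁻¹))⁻¹ * x * s (π f⁻¹), ht hx.1 hfO⟩ : ↥(A ⊓ N)) =
        ⟨(s (π f⁻¹))⁻¹ * x * s (π f⁻¹), hmem⟩ := by
      apply Subtype.ext
      change (s (π x * π f⁻¹))⁻¹ * x * s (π f⁻¹) = (s (π f⁻¹))⁻¹ * x * s (π f⁻¹)
      rw [hπN.mpr hx.2, one_mul]
    rw [heq, apply_conj_eq φ hx hsf hmem]
  · -- `χ (g x g⁻¹) = 1` off the orbit of `π f⁻¹`
    rw [hχ_conj g x hx]
    refine hc_of_not fun hgO => hg ?_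
    have h1 : π (g⁻¹ * f) ∈ Abar := by rw [map_mul]; exact hgO
    obtain ⟨a, ha, n, hn, h⟩ := Set.mem_mul.mp (hAN.mp h1)
    rw [← normal_coe_mul_comm A N]
    refine Set.mem_mul.mpr ⟨n⁻¹, N.inv_mem hn, a⁻¹, A.inv_mem ha, ?_⟩
    rw [← mul_inv_rev, h, mul_inv_rev, inv_inv]

/-- `Γ_S ∩ N ≠ 1` as soon as `S ≠ ∅` and `N` has finite index (it contains `b_i^{[Γ:N]} ≠ 1`).
[cite: SerreTrees1980, I §5.5 Thm. 14] -/
theorem freeFactor_inf_ne_bot (b : FreeGroupBasis β Γ) {S : Set β} (hS : S.Nonempty)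
    (A : Subgroup Γ) (hA : A = Subgroup.closure (b '' S))
    (N : Subgroup Γ) [N.Normal] [hfi : N.FiniteIndex] : A ⊓ N ≠ ⊥ := by
  classical
  obtain ⟨i, hi⟩ := hS
  intro h
  have hiA : b i ∈ A := by rw [hA]; exact Subgroup.subset_closure (Set.mem_image_of_mem b hi)
  have hmem : b i ^ N.index ∈ A ⊓ N :=
    Subgroup.mem_inf.mpr ⟨Subgroup.pow_mem A hiA _, Subgroup.pow_index_mem N (b i)⟩
  rw [h, Subgroup.mem_bot] at hmem
  let e : Γ →* Multiplicative ℤ := b.lift fun j => if j = i then Multiplicative.ofAdd 1 else 1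
  have he : e (b i) = Multiplicative.ofAdd 1 := by
    have h0 := lift_apply_basis b (fun j => if j = i then Multiplicative.ofAdd (1 : ℤ) else 1) i
    rw [if_pos rfl] at h0
    exact h0
  have h1 := congrArg e hmem
  rw [map_pow, map_one e, he, ← ofAdd_nsmul, nsmul_one, ← ofAdd_zero] at h1
  have h2 : ((N.index : ℕ) : ℤ) = 0 := Multiplicative.ofAdd.injective h1
  exact hfi.index_ne_zero (by exact_mod_cast h2)

/-- **Separating normal subgroup of prime index** ([CombGC] Prop. 1.2, proof p. 9, the verticial
separating covering at ONE vertex, discrete form).  For a free group `Γ` with basis `b`, `S ⊆ β`,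
`Γ_S = ⟨b(S)⟩`, `N ⊴ Γ` with `B = Γ_S ∩ N ≠ 1`, a prime `ℓ` and `f ∈ Γ`: there is `U ⊴ N` of index `ℓ`
with `f B f⁻¹ ⊄ U` and `g B g⁻¹ ⊆ U` for every `g` with `f⁻¹ g ∉ Γ_S·N`.
[cite: SerreTrees1980, I §5.5 Thm. 14] -/
theorem exists_normal_index_eq_separating_of_freeFactor (b : FreeGroupBasis β Γ) (S : Set β)
    (A : Subgroup Γ) (hA : A = Subgroup.closure (b '' S)) (N : Subgroup Γ) [hN : N.Normal]
    (hB : A ⊓ N ≠ ⊥) {ℓ : ℕ} (hℓ : ℓ.Prime) (f : Γ) :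
    ∃ U : Subgroup N, U.Normal ∧ U.index = ℓ ∧
      ¬ (ConjAct.toConjAct f • (A ⊓ N) ≤ U.map N.subtype) ∧
      ∀ g : Γ, f⁻¹ * g ∉ (A : Set Γ) * (N : Set Γ) →
        ConjAct.toConjAct g • (A ⊓ N) ≤ U.map N.subtype := by
  classical
  set B : Subgroup Γ := A ⊓ N with hBdef
  haveI : IsFreeGroup Γ := b.isFreeGroup
  haveI : IsFreeGroup B := subgroupIsFreeOfIsFree B
  haveI : Fact (1 < ℓ) := ⟨hℓ.one_lt⟩
  -- a nontrivial character of the free group `B ≠ 1`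
  obtain ⟨x₀, hx₀B, hx₀⟩ : ∃ x ∈ B, x ≠ 1 := by
    by_contra h
    push Not at h
    exact hB ((Subgroup.eq_bot_iff_forall _).mpr h)
  have hgen : Nonempty (IsFreeGroup.Generators B) := by
    by_contra h
    rw [not_nonempty_iff] at h
    haveI : Subsingleton B := (IsFreeGroup.toFreeGroup B).toEquiv.subsingleton
    exact hx₀ (congrArg Subtype.val (Subsingleton.elim (⟨x₀, hx₀B⟩ : B) 1))
  obtain ⟨g₀⟩ := hgen
  let φ : B →* Multiplicative (ZMod ℓ) := IsFreeGroup.lift fun _ => Multiplicative.ofAdd 1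
  set y : B := IsFreeGroup.of g₀ with hy
  have hφy : φ y ≠ 1 := by
    have h0 : φ y = Multiplicative.ofAdd 1 := IsFreeGroup.lift_of _ _
    rw [h0]
    intro h1
    exact one_ne_zero (Multiplicative.ofAdd.injective (h1.trans ofAdd_zero.symm))
  obtain ⟨χ, hχf, hχg⟩ := exists_character_extension_of_freeFactor b S A hA N φ f
  have hyf : χ ⟨f * (y : Γ) * f⁻¹, hN.conj_mem _ y.2.2 f⟩ = φ y := hχf y y.2
  refine ⟨χ.ker, inferInstance, ?_, ?_, ?_⟩
  · -- the index is `ℓ`: `χ` is onto the cyclic group of prime order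
    haveI : Fact (Nat.card (Multiplicative (ZMod ℓ))).Prime :=
      ⟨by rw [show Nat.card (Multiplicative (ZMod ℓ)) = ℓ from Nat.card_zmod ℓ]; exact hℓ⟩
    rw [Subgroup.index_ker]
    rcases χ.range.eq_bot_or_eq_top_of_prime_card with h | h
    · exfalso
      apply hφy
      have hm : χ ⟨f * (y : Γ) * f⁻¹, hN.conj_mem _ y.2.2 f⟩ ∈ χ.range := ⟨_, rfl⟩
      rw [h, Subgroup.mem_bot] at hm
      rw [← hyf, hm]
    · rw [h, Subgroup.card_top]
      exact Nat.card_zmod ℓ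
  · -- nontrivial over the vertex of `f`
    intro hle
    apply hφy
    have hm : ConjAct.toConjAct f • (y : Γ) ∈ ConjAct.toConjAct f • B :=
      Subgroup.smul_mem_pointwise_smul _ _ _ y.2
    rw [ConjAct.smul_def, ConjAct.ofConjAct_toConjAct] at hm
    obtain ⟨u, hu, hu'⟩ := Subgroup.mem_map.mp (hle hm)
    have hu'' : u = ⟨f * (y : Γ) * f⁻¹, hN.conj_mem _ y.2.2 f⟩ := Subtype.ext hu'
    rw [← hyf, ← hu'']
    exact hu
  · -- trivial over every other vertex
    intro g hg z hz
    obtain ⟨x, hxB, rfl⟩ := (Subgroup.mem_smul_pointwise_iff_exists _ _ _).mp hz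
    rw [ConjAct.smul_def, ConjAct.ofConjAct_toConjAct]
    exact Subgroup.mem_map.mpr ⟨⟨g * x * g⁻¹, hN.conj_mem x hxB.2 g⟩, hχg g hg x hxB, rfl⟩

end FreeFactorFibredTwist

end Literature.GroupTheory.CombinatorialGroupTheory
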